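import Literature.MathematicalPhysics.QuantumFieldTheory.Balaban1983to89.B9Thm312WholeLeaf
import Literature.MathematicalPhysics.QuantumFieldTheory.Balaban1983to89.B9RWSums346Schur

/-!
# `Balaban1983to89.B9SupLettersFromClassLetters` — [B9] p. 398 *"the choice of powers Lʲη … is conventional"*: the plain [4]-(2.51) SUP MAJORANTS
# (flat kernel, or a weight at the OUTPUT block) READ OUT OF the state-norm class majorants `𝔠⁽²⁾ → 𝔠⁽²⁾` and `𝔠⁽²⁾ → (n⁻¹-weighted coarse class)` by ONE scale transfer

T. Bałaban, *Propagators for lattice gauge theories in a background field*, Commun. Math. Phys. **99** (1985) 389–434 [`Balaban1985BackgroundPropagators`,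
"B9"]; [4] = T. Bałaban, *Propagators and renormalization transformations for lattice gauge theories. II*, Commun. Math. Phys. **96** (1984) 223–250
[`Balaban1984PropagatorsII`].  statement-level skeleton of published theorems with citation tags; proofs where landed; nothing here is a claim about the
Yang–Mills mass gap.

THE POINT (seat n06-w8 g2′, successor note to `…N06HTransposeAtPinsPhys`, cell bus 2026-08-28; WIDTH-209 N06).  The N06 certificate states Thm 3.12's letters in the
STATE-NORM classes (`B9Thm312Whole.cNorm … p` = sharp-block sup rescaled by `(Lʲη)^{−p}`; `B9Thm312WholeHZ.LettersHZ.c2 : HasMaj (cNorm … 2) bZ (C U) (B₃e^{−δ₃d})`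
with `bZ` = the `n⁻¹`-weighted coarse class), while this seat's (H\*J)-road file `…N06HTransposeAtPinsPhys` asks the PLAIN [4]-(2.51) sup letters
`hGDsup : HasMajorant blk (G_D U) (r_G·e^{−(1−α)δ d})` and `hCsup : HasMajorant blkZ (C U) (r_C·W_C(a)·e^{−δ d})` (weight at the OUTPUT coarse block).  THIS FILE is
the dictionary between the two currencies (n06-l `B9Thm312WholeLeaf.hasMajorantHom_of_hasMaj_cNorm` + the p. 398 transfer of the one `(Lʲη)²∕(L^{j′}η)²` ratio,
`B9RWSums346Schur.scaleTransfer_len_rpow` at `γ = ±2` under the member facts `Facts347`):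
* §1 ★ `hasMajorant_of_hasMaj_cNorm_two` — `HasMaj 𝔠⁽²⁾ 𝔠⁽²⁾ T (B·e^{−δd})` ⟹ `HasMajorant blk T (B·L₀²·e^{−(δ−αδ₁)d})` (the `G_D` letter);
* §2 ★ `hasMajorant_of_hasMaj_cNorm_weightNorm` — `HasMaj 𝔠⁽²⁾ (W-weighted sup class) T (B·e^{−δd})`, `W > 0` ⟹ `HasMajorant blk T (B·L₀²·(W(a)⁻¹·(Lʲη)_a⁻²)·e^{−(δ−αδ₁)d})`
  (the `C` letter WITH the output weight `W_C(a) = W(a)⁻¹·(Lʲη)_a⁻²` — at the record `W = n⁻¹`, so `W_C = n_a·(Lʲη)_a⁻²`, the flat `C(b,b) ≍ n_b·(Lʲη)_b⁻²` of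
  dag-n06-h ∕ node00-def-Y (W2)).
HONEST SCOPE.  Class bookkeeping ([4] (2.51), p. 398's remark, (2.60) in the form of the member facts); nothing of [B9] asserted; count-neutral; N06 NOT discharged;
one finite lattice at a time — nothing continuum ∕ ℝ⁴ ∕ OS ∕ mass gap ∕ Clay.  Cell `pub-ymgap` (HUMAN RULING D-0062), Track A node N06 [B9], seat
`pub-ymgap-dag-n06-w8` (g2′), 2026-08-28.  NEW file; `hasMajorantHom_of_hasMaj_cNorm`, `scaleTransfer_len_rpow`, `abs_apply_le_ofBlocks_loc`,
`ofBlocks_loc_le_of_blockSupp` consumed BY NAME.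
-/

noncomputable section

namespace Literature.MathematicalPhysics.QuantumFieldTheory.Balaban1983to89.B9SupLettersFromClassLetters

open B6RandomWalk (HasMajorant BlockSupp)
open B6RandomWalkHom (HasMajorantHom hasMajorantHom_iff hasMajorantHom_mono)
open B9Thm34Ext (toB6)
open B11SectG (HasMaj BlockNorm)
open B9SectDSup (weightNorm weightNorm_loc)
open B9Thm312Whole (cNorm GeoOK wt wt_pos wt_nonneg)
open B9Thm312WholeLeaf (hasMajorantHom_of_hasMaj_cNorm)
open B9Thm37AllNormsInstances (abs_apply_le_ofBlocks_loc ofBlocks_loc_le_of_blockSupp)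
open B9RWSums343to347Whole (Facts347)
open B9RWSums346Schur (scaleTransfer_len_rpow)

variable {g : B9.Geometry} [Fintype g.Site] {X V : Type} [Fintype X] [Fintype V] {R₀ : ℝ} {H₀ : Prop}

/-- the p. 398 transfer of the ONE ratio `(Lʲη)_a² ∕ (L^{j′}η)_b²` against `e^{−α₁δ₁ d(a,b)}` under the member facts: `≦ L₀²`.
[cite: Balaban1985BackgroundPropagators, p.398 (remark after (3.47)); Balaban1984PropagatorsII, Lemma 2.1 (2.60) p.234] -/
theorem len_sq_ratio_transfer (hG : GeoOK g) {dF : ℕ} {δ₁ α₁ L₀ : ℝ} (hF : Facts347 g R₀ H₀ dF δ₁ α₁ L₀) (a b : g.Site) :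
    Real.exp (-(α₁ * δ₁ * g.dist a b)) * (g.len a ^ 2 * (g.len b ^ 2)⁻¹) ≤ L₀ ^ 2 := by
  -- `scaleTransfer_len_rpow` at γ = −2, pair (a, b): e^{−αδ d(a,b)}·(len b)^{−2} ≤ L^{2}·(len a)^{−2}
  have hst := scaleTransfer_len_rpow hF (-2) (by norm_num) a b
  have ha := hG.lenpos a
  have hb := hG.lenpos b
  have e1 : (g.len b ^ 2)⁻¹ = g.len b ^ (-2 : ℝ) := by
    rw [show (-2 : ℝ) = -((2 : ℕ) : ℝ) by norm_num, Real.rpow_neg hb.le, Real.rpow_natCast]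
  have e2 : (g.len a ^ 2)⁻¹ = g.len a ^ (-2 : ℝ) := by
    rw [show (-2 : ℝ) = -((2 : ℕ) : ℝ) by norm_num, Real.rpow_neg ha.le, Real.rpow_natCast]
  have hL1 : 1 ≤ g.L := hF.one_le_L
  have hLle : g.L ^ |(-2 : ℝ)| ≤ L₀ ^ 2 := by
    rw [show |(-2 : ℝ)| = (2 : ℕ) by norm_num, Real.rpow_natCast]
    exact pow_le_pow_left₀ (zero_le_one.trans hL1) hF.L_le 2
  have ha2 : 0 < g.len a ^ 2 := pow_pos ha 2
  -- multiply the transfer by (len a)² > 0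
  have h1 : Real.exp (-(α₁ * δ₁ * g.dist a b)) * (g.len b ^ 2)⁻¹ ≤ L₀ ^ 2 * (g.len a ^ 2)⁻¹ := by
    rw [e1, e2]; exact hst.trans (mul_le_mul_of_nonneg_right hLle (Real.rpow_nonneg ha.le _))
  calc Real.exp (-(α₁ * δ₁ * g.dist a b)) * (g.len a ^ 2 * (g.len b ^ 2)⁻¹)
      = (Real.exp (-(α₁ * δ₁ * g.dist a b)) * (g.len b ^ 2)⁻¹) * g.len a ^ 2 := by ring
    _ ≤ (L₀ ^ 2 * (g.len a ^ 2)⁻¹) * g.len a ^ 2 := mul_le_mul_of_nonneg_right h1 ha2.le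
    _ = L₀ ^ 2 := by rw [mul_assoc, inv_mul_cancel₀ ha2.ne', mul_one]

/-- ★ **THE PLAIN SUP LETTER OF A `𝔠⁽²⁾ → 𝔠⁽²⁾` CLASS LETTER** (the `G_D` letter of (3.130) for the (H\*J) road): `HasMaj 𝔠⁽²⁾ 𝔠⁽²⁾ T (B·e^{−δd})` gives
`HasMajorant blk T (B·L₀²·e^{−(δ−α₁δ₁)d})` — the weights `(Lʲη)_a²·(L^{j′}η)_b⁻²` moved into the kernel (`hasMajorantHom_of_hasMaj_cNorm`) and transferred
(`len_sq_ratio_transfer`). [cite: Balaban1985BackgroundPropagators, (3.130) p.421, (3.42) p.397, p.398 (remark after (3.47)); Balaban1984PropagatorsII, (2.51) p.232, Lemma 2.1 (2.60) p.234] -/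
theorem hasMajorant_of_hasMaj_cNorm_two (hG : GeoOK g) {dF : ℕ} {δ₁ α₁ L₀ : ℝ} (hF : Facts347 g R₀ H₀ dF δ₁ α₁ L₀)
    {blk : X → g.Site} {T : Module.End ℝ (X → ℝ)} {B δ : ℝ} (hB : 0 ≤ B)
    (h : HasMaj (cNorm R₀ H₀ blk hG.lenle 2) (cNorm R₀ H₀ blk hG.lenle 2) T (fun a b => B * Real.exp (-(δ * g.dist a b)))) :
    HasMajorant (g := toB6 g R₀ H₀) blk T (fun a b => B * L₀ ^ 2 * Real.exp (-((δ - α₁ * δ₁) * g.dist a b))) := by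
  have hhom := hasMajorantHom_of_hasMaj_cNorm (R₀ := R₀) (H₀ := H₀) hG (fun a b => mul_nonneg hB (Real.exp_nonneg _)) h
  rw [← hasMajorantHom_iff]
  refine hasMajorantHom_mono _ _ hhom fun a b => ?_
  have ht := len_sq_ratio_transfer (R₀ := R₀) (H₀ := H₀) hG hF a b
  have hsplit : Real.exp (-(δ * g.dist a b)) = Real.exp (-((δ - α₁ * δ₁) * g.dist a b)) * Real.exp (-(α₁ * δ₁ * g.dist a b)) := by
    rw [← Real.exp_add]; ring_nf
  simp only [wt]
  calc B * Real.exp (-(δ * g.dist a b)) * g.len a ^ 2 * (g.len b ^ 2)⁻¹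
      = B * Real.exp (-((δ - α₁ * δ₁) * g.dist a b)) * (Real.exp (-(α₁ * δ₁ * g.dist a b)) * (g.len a ^ 2 * (g.len b ^ 2)⁻¹)) := by
        rw [hsplit]; ring
    _ ≤ B * Real.exp (-((δ - α₁ * δ₁) * g.dist a b)) * L₀ ^ 2 :=
        mul_le_mul_of_nonneg_left ht (mul_nonneg hB (Real.exp_nonneg _))
    _ = B * L₀ ^ 2 * Real.exp (-((δ - α₁ * δ₁) * g.dist a b)) := by ring

/-- ★ **THE PLAIN SUP LETTER, WITH THE OUTPUT WEIGHT, OF A `𝔠⁽²⁾ → (W-weighted sup class)` CLASS LETTER** (the `C = (QGQ\*)⁻¹` letter of (3.132) for the (H\*J)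
road; at the record `W = n⁻¹`, dag-n06-l's `LettersHZ.c2` with `bZ := weightNorm (ofBlocks blkZ) n⁻¹`): `HasMaj 𝔠⁽²⁾_V (weightNorm (ofBlocks blk) W) T (B·e^{−δd})`
with `W > 0` gives `HasMajorant`-type `HasMajorantHom blkV blk T (B·L₀²·(W(a)⁻¹·(Lʲη)_a⁻²)·e^{−(δ−α₁δ₁)d})` — the target weight `W(a)` and the source weight
`(L^{j′}η)_b⁻²` moved into the kernel, the latter transferred to the output block.
[cite: Balaban1985BackgroundPropagators, (3.132) p.422, (3.42) p.397, p.398 (remark after (3.47)); Balaban1984PropagatorsII, (2.51) p.232, Lemma 2.1 (2.60) p.234; Balaban1984PropagatorsI, (1.18) p.20] -/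
theorem hasMajorantHom_of_hasMaj_cNorm_weightNorm (hG : GeoOK g) {dF : ℕ} {δ₁ α₁ L₀ : ℝ} (hF : Facts347 g R₀ H₀ dF δ₁ α₁ L₀)
    {blkV : V → g.Site} {blk : X → g.Site} {T : (V → ℝ) →ₗ[ℝ] (X → ℝ)} {B δ : ℝ} (hB : 0 ≤ B)
    {W : g.Site → ℝ} (hW : ∀ y, 0 < W y)
    (h : HasMaj (cNorm R₀ H₀ blkV hG.lenle 2) (weightNorm (BlockNorm.ofBlocks (toB6 g R₀ H₀) blk) W fun y => (hW y).le) T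
      (fun a b => B * Real.exp (-(δ * g.dist a b)))) :
    HasMajorantHom (g := toB6 g R₀ H₀) blkV blk T
      (fun a b => B * L₀ ^ 2 * ((W a)⁻¹ * (g.len a ^ 2)⁻¹) * Real.exp (-((δ - α₁ * δ₁) * g.dist a b))) := by
  intro y' μ B' hμ x
  have hloc : (cNorm R₀ H₀ blkV hG.lenle 2).IsLoc y' μ := fun v hv => hμ.off v hv
  have hb := h y' μ hloc (blk x)
  simp only [cNorm, weightNorm_loc] at hb
  have hWx : 0 < W (blk x) := hW (blk x)
  have h1 : |T μ x| ≤ (BlockNorm.ofBlocks (toB6 g R₀ H₀) blk).loc (blk x) (T μ) :=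
    abs_apply_le_ofBlocks_loc (G := toB6 g R₀ H₀) blk (blk x) (T μ) x rfl
  have h2 : (BlockNorm.ofBlocks (toB6 g R₀ H₀) blkV).loc y' μ ≤ B' :=
    ofBlocks_loc_le_of_blockSupp (G := toB6 g R₀ H₀) blkV hμ
  have hK0 : 0 ≤ B * Real.exp (-(δ * g.dist (blk x) y')) := mul_nonneg hB (Real.exp_nonneg _)
  -- the class inequality, solved for the sharp-block sup of `Tμ`
  have h3 : (BlockNorm.ofBlocks (toB6 g R₀ H₀) blk).loc (blk x) (T μ) ≤
      (W (blk x))⁻¹ * (B * Real.exp (-(δ * g.dist (blk x) y')) * (wt g 2 y' * B')) := by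
    rw [le_inv_mul_iff₀ hWx]
    exact hb.trans (mul_le_mul_of_nonneg_left (mul_le_mul_of_nonneg_left h2 (wt_nonneg hG.lenle 2 y')) hK0)
  -- the transfer of the source weight (L^{j′}η)_{y′}⁻² to the output block
  have ht := len_sq_ratio_transfer (R₀ := R₀) (H₀ := H₀) hG hF (blk x) y'
  have hx2 : 0 < g.len (blk x) ^ 2 := pow_pos (hG.lenpos (blk x)) 2
  have hsplit : Real.exp (-(δ * g.dist (blk x) y')) =
      Real.exp (-((δ - α₁ * δ₁) * g.dist (blk x) y')) * Real.exp (-(α₁ * δ₁ * g.dist (blk x) y')) := by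
    rw [← Real.exp_add]; ring_nf
  have hwt : wt g 2 y' = (g.len (blk x) ^ 2)⁻¹ * (g.len (blk x) ^ 2 * (g.len y' ^ 2)⁻¹) := by
    simp only [wt]; rw [← mul_assoc, inv_mul_cancel₀ hx2.ne', one_mul]
  calc |T μ x| ≤ (W (blk x))⁻¹ * (B * Real.exp (-(δ * g.dist (blk x) y')) * (wt g 2 y' * B')) := h1.trans h3
    _ = (W (blk x))⁻¹ * B * (g.len (blk x) ^ 2)⁻¹ * Real.exp (-((δ - α₁ * δ₁) * g.dist (blk x) y')) *
          (Real.exp (-(α₁ * δ₁ * g.dist (blk x) y')) * (g.len (blk x) ^ 2 * (g.len y' ^ 2)⁻¹)) * B' := by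
        rw [hsplit, hwt]; ring
    _ ≤ (W (blk x))⁻¹ * B * (g.len (blk x) ^ 2)⁻¹ * Real.exp (-((δ - α₁ * δ₁) * g.dist (blk x) y')) * L₀ ^ 2 * B' := by
        refine mul_le_mul_of_nonneg_right (mul_le_mul_of_nonneg_left ht ?_) hμ.nonneg
        exact mul_nonneg (mul_nonneg (mul_nonneg (inv_nonneg.mpr hWx.le) hB) (inv_nonneg.mpr hx2.le)) (Real.exp_nonneg _)
    _ = B * L₀ ^ 2 * ((W (blk x))⁻¹ * (g.len (blk x) ^ 2)⁻¹) * Real.exp (-((δ - α₁ * δ₁) * g.dist (blk x) y')) * B' := by ring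

end Literature.MathematicalPhysics.QuantumFieldTheory.Balaban1983to89.B9SupLettersFromClassLetters

end
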